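import Literature.AlgebraicGeometry.Frobenioids.Thm49Assembly
import Literature.AlgebraicGeometry.Frobenioids.Thm49AssemblyFSMFF2024
import Literature.AlgebraicGeometry.Frobenioids.Thm49OfPreSteps
import Literature.AlgebraicGeometry.Frobenioids.Prop55SubRatStdRlfClosers
import HarnessLib

/-!
# [FrdI] Theorem 4.9 AS TYPED at THE Def. 4.5 (iii) parameters `PreFrobenioid.rsParams` — no rationality
# side-hypothesis (node FrdI:Thm4.9; sequel of `Thm49Assembly.lean`)

Mochizuki, *The geometry of Frobenioids I: the general theory*, Kyushu J. Math. **62** (2008) 293–400,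
§4, Theorem 4.9 p. 88 (statement p. 88 l. 33 – p. 89 l. 2), Definition 4.5 (ii)/(iii) p. 86
[cite: MochizukiFrdI2008, Thm. 4.9 p.88] [cite: MochizukiFrdI2008, Def. 4.5 (iii) p.86].

PROOF-ONLY file (seat abc-iut-w4-d109, T49-L00 lineage), 0 definitions. The cell's closers of the typed
`PreFrobenioidData.Thm49 (ofFunctor Φ₁ F₁) (ofFunctor Φ₂ F₂) Ψ R₁ R₂` —
`FrdI.T49.thm49_ofFunctor_of_isOfFSMType` (bases of FSM-type, seat abc-iut-w4-d109),
`FrdI.T49.thm49_ofFunctor_of_isOfFSMFFType2024` (bases of FSMFF-type in the author's 2024 wording, seat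
abc-iut-w4-d109) and `FrdI.T49.thm49_ofFunctor_of_preservesPreSteps` (print's generality modulo "`Ψ`, `Ψ⁻¹`
preserve pre-steps", seat abc-iut-w4-d105) — are stated for ARBITRARY (data-only) parameters `R₁, R₂ : RSParams`
and therefore carry ONE binder that print does not display: `hrat₁`, "every object of `C₁` is rational (Def. 4.5
(ii)) at THE birationalization `C₁ → C₁^birat` of Prop. 4.4 and the primary support of Def. 2.4 (i)(d)" — the
"rational type" conjunct of the antecedent "`C₁` is of rationally standard type" READ AT THE CONSTRUCTIONS, which
a data-only `R₁` cannot be assumed to carry.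

AT THE PARAMETERS OF RECORD `R₁ := PreFrobenioid.rsParams hF₁ Supp₁` (THE birationalization, THE
unit-trivialization `C₁^un-tr` and ITS birationalization — `Prop55Sub.lean`, seats abc-iut-L6-t6/L6-t8/L1-d5 —
with any support predicate `Supp₁` extensionally equal to the primary support, in particular `PrimarySupp`
itself) that binder IS the "rational" conjunct of the typed antecedent `IsOfRationallyStandardType R₁`
(`isRational_primarySupp_of_rsParams`, via seat abc-iut-w5-d250's `PreFrobenioidData.isRational_congr_supp`:
Def. 4.5 (ii) only sees the extension of the support predicate). Hence the typed Thm. 4.9 at THE parameters holds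
under EXACTLY print's standing hypotheses — `C_i → F_{Φ_i}` Frobenioids, `Φ_i` perf-factorial, and the base /
pre-step clause of the respective closer — with no rationality side-hypothesis:

* `FrdI.T49.thm49_rsParams_of_isOfFSMType`, `…_primarySupp` (bases of FSM-type);
* `FrdI.T49.thm49_rsParams_of_isOfFSMFFType2024`, `…_primarySupp` (bases of FSMFF-type, 2024 wording);
* `FrdI.T49.thm49_rsParams_of_preservesPreSteps`, `…_primarySupp` (no base hypothesis; `Ψ^{±1}` preserve
  pre-steps, Thm. 3.4 (ii)).

This is the Thm. 4.9 analogue of the Cor. 4.12 lineage's `FrdI.cor412_rsParams_of_isOfFSMType`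
(`Cor412Unconditional.lean`, seat abc-iut-w5-d222). Honest scope: for a junk support predicate `Supp₁` (not
extensionally the primary support) the typed antecedent at `rsParams hF₁ Supp₁` does not yield rationality at the
primary support, and no closer is claimed. No statement of the paper is restated or strengthened; nothing here
bears on, or takes a side on, [IUTchIII] Cor. 3.12.
-/

namespace Literature.AlgebraicGeometry.Frobenioids

namespace FrdI.T49

open CategoryTheory Opposite PreFrobenioidData PreFrobenioid

universe w v v' u u'

variable {D₁ : Type u} [Category.{v} D₁] {Φ₁ : D₁ᵒᵖ ⥤ CommMonCat.{w}} {C₁ : Type u'} [Category.{v'} C₁]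
  {D₂ : Type u} [Category.{v} D₂] {Φ₂ : D₂ᵒᵖ ⥤ CommMonCat.{w}} {C₂ : Type u'} [Category.{v'} C₂]
  {F₁ : C₁ ⥤ ElemFrobenioid Φ₁} {F₂ : C₂ ⥤ ElemFrobenioid Φ₂}

/-! ### The rationality binder IS the typed antecedent at THE parameters -/

/-- **At THE parameters the closers' binder `hrat₁` is the "rational" conjunct of the typed antecedent**: if
`C₁` is of rationally standard type (Def. 4.5 (iii)) with respect to `PreFrobenioid.rsParams hF₁ Supp₁`, for a
support predicate `Supp₁` extensionally equal to the primary support of Def. 2.4 (i)(d), then every object of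
`C₁` is rational (Def. 4.5 (ii)) at THE birationalization and the primary support. (Def. 4.5 (ii) depends on the
support predicate only through its extension — `PreFrobenioidData.isRational_congr_supp`.)
[cite: MochizukiFrdI2008, Def. 4.5 (iii) p.86] -/
theorem isRational_primarySupp_of_rsParams (hF₁ : IsFrobenioid F₁)
    {Supp₁ : ∀ {X : D₁}, (ofFunctor Φ₁ F₁).Mon X → Primes ((ofFunctor Φ₁ F₁).Mon X) → Prop}
    (hSupp₁ : ∀ (X : D₁) (a : (ofFunctor Φ₁ F₁).Mon X) (𝔭 : Primes ((ofFunctor Φ₁ F₁).Mon X)),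
      Supp₁ a 𝔭 ↔ PrimarySupp a 𝔭)
    (hR₁ : (ofFunctor Φ₁ F₁).IsOfRationallyStandardType (rsParams hF₁ Supp₁)) (A : C₁) :
    PreFrobenioidData.IsRational (biratData hF₁ (hasBiratSquares_of_isFrobenioid hF₁))
      (S := ofFunctor Φ₁ F₁) (fun a 𝔭 => PrimarySupp a 𝔭) A :=
  (PreFrobenioidData.isRational_congr_supp (S := ofFunctor Φ₁ F₁)
    (biratData hF₁ (hasBiratSquares_of_isFrobenioid hF₁)) hSupp₁ A).mp (hR₁.rational A)

/-- The same at the primary support itself: rationally standard type with respect to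
`rsParams hF₁ PrimarySupp` contains "every object is rational at THE birationalization and the primary support"
as its "rational" conjunct. [cite: MochizukiFrdI2008, Def. 4.5 (iii) p.86] -/
theorem isRational_of_rsParams_primarySupp (hF₁ : IsFrobenioid F₁)
    (hR₁ : (ofFunctor Φ₁ F₁).IsOfRationallyStandardType (rsParams hF₁ fun a 𝔭 => PrimarySupp a 𝔭))
    (A : C₁) :
    PreFrobenioidData.IsRational (biratData hF₁ (hasBiratSquares_of_isFrobenioid hF₁))
      (S := ofFunctor Φ₁ F₁) (fun a 𝔭 => PrimarySupp a 𝔭) A :=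
  hR₁.rational A

/-! ### Theorem 4.9 at THE parameters, bases of FSM-type -/

/-- **[FrdI] Thm. 4.9 AS TYPED at THE Def. 4.5 (iii) parameters, bases of FSM-type — no rationality
side-hypothesis**: for Frobenioids `C_i → F_{Φ_i}` with perf-factorial `Φ_i` over bases of FSM-type, any
equivalence `Ψ : C₁ ⥲ C₂`, and the parameters `rsParams hF_i Supp_i` with `Supp₁` extensionally the primary
support: "if `C₁`, `C₂` are of rationally standard type, there exists an isomorphism of functors
`Ψ^Φ : Φ₁ ⥲ Φ₂` lying over `Ψ`". The antecedent supplies the rationality the FSM closer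
`thm49_ofFunctor_of_isOfFSMType` asks for. [cite: MochizukiFrdI2008, Thm. 4.9 p.88] -/
theorem thm49_rsParams_of_isOfFSMType (hF₁ : IsFrobenioid F₁) (hF₂ : IsFrobenioid F₂)
    (hD₁ : IsOfFSMType D₁) (hD₂ : IsOfFSMType D₂)
    (hpf₁ : Objectwise (fun M _ => IsPerfFactorial M) Φ₁) (hpf₂ : Objectwise (fun M _ => IsPerfFactorial M) Φ₂)
    (Ψ : C₁ ≌ C₂)
    {Supp₁ : ∀ {X : D₁}, (ofFunctor Φ₁ F₁).Mon X → Primes ((ofFunctor Φ₁ F₁).Mon X) → Prop}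
    (hSupp₁ : ∀ (X : D₁) (a : (ofFunctor Φ₁ F₁).Mon X) (𝔭 : Primes ((ofFunctor Φ₁ F₁).Mon X)),
      Supp₁ a 𝔭 ↔ PrimarySupp a 𝔭)
    (Supp₂ : ∀ {X : D₂}, (ofFunctor Φ₂ F₂).Mon X → Primes ((ofFunctor Φ₂ F₂).Mon X) → Prop) :
    (ofFunctor Φ₁ F₁).Thm49 (ofFunctor Φ₂ F₂) Ψ (rsParams hF₁ Supp₁) (rsParams hF₂ Supp₂) :=
  fun hR₁ hR₂ =>
    thm49_ofFunctor_of_isOfFSMType hF₁ hF₂ hD₁ hD₂ hpf₁ hpf₂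
      (isRational_primarySupp_of_rsParams hF₁ hSupp₁ hR₁) Ψ _ _ hR₁ hR₂

/-- **[FrdI] Thm. 4.9 AS TYPED at THE parameters with THE primary support, bases of FSM-type** — hypotheses =
print's standing ones only (Frobenioids, perf-factorial `Φ_i`, FSM-type bases).
[cite: MochizukiFrdI2008, Thm. 4.9 p.88] -/
theorem thm49_rsParams_primarySupp_of_isOfFSMType (hF₁ : IsFrobenioid F₁) (hF₂ : IsFrobenioid F₂)
    (hD₁ : IsOfFSMType D₁) (hD₂ : IsOfFSMType D₂)
    (hpf₁ : Objectwise (fun M _ => IsPerfFactorial M) Φ₁) (hpf₂ : Objectwise (fun M _ => IsPerfFactorial M) Φ₂)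
    (Ψ : C₁ ≌ C₂) :
    (ofFunctor Φ₁ F₁).Thm49 (ofFunctor Φ₂ F₂) Ψ (rsParams hF₁ fun a 𝔭 => PrimarySupp a 𝔭)
      (rsParams hF₂ fun a 𝔭 => PrimarySupp a 𝔭) :=
  thm49_rsParams_of_isOfFSMType hF₁ hF₂ hD₁ hD₂ hpf₁ hpf₂ Ψ (fun _ _ _ => Iff.rfl) _

/-- The conclusion outright at THE parameters, bases of FSM-type: if `C₁`, `C₂` are of rationally standard type at
`rsParams hF_i PrimarySupp`, then `Ψ^Φ : Φ₁ ⥲ Φ₂` over `Ψ` exists. [cite: MochizukiFrdI2008, Thm. 4.9 p.88] -/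
theorem nonempty_divisorMonoidIsoOver_of_rsParams_of_isOfFSMType (hF₁ : IsFrobenioid F₁) (hF₂ : IsFrobenioid F₂)
    (hD₁ : IsOfFSMType D₁) (hD₂ : IsOfFSMType D₂)
    (hpf₁ : Objectwise (fun M _ => IsPerfFactorial M) Φ₁) (hpf₂ : Objectwise (fun M _ => IsPerfFactorial M) Φ₂)
    (Ψ : C₁ ≌ C₂)
    (hR₁ : (ofFunctor Φ₁ F₁).IsOfRationallyStandardType (rsParams hF₁ fun a 𝔭 => PrimarySupp a 𝔭))
    (hR₂ : (ofFunctor Φ₂ F₂).IsOfRationallyStandardType (rsParams hF₂ fun a 𝔭 => PrimarySupp a 𝔭)) :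
    Nonempty (DivisorMonoidIsoOver (ofFunctor Φ₁ F₁) (ofFunctor Φ₂ F₂) Ψ) :=
  thm49_rsParams_primarySupp_of_isOfFSMType hF₁ hF₂ hD₁ hD₂ hpf₁ hpf₂ Ψ hR₁ hR₂

/-! ### Theorem 4.9 at THE parameters, bases of FSMFF-type (2024 wording) -/

/-- **[FrdI] Thm. 4.9 AS TYPED at THE Def. 4.5 (iii) parameters, bases of FSMFF-type in the author's 2024
wording — no rationality side-hypothesis** (`Supp₁` extensionally the primary support).
[cite: MochizukiFrdI2008, Thm. 4.9 p.88] [cite: MochizukiFrdIComments2024, (28) p.3] -/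
theorem thm49_rsParams_of_isOfFSMFFType2024 (hF₁ : IsFrobenioid F₁) (hF₂ : IsFrobenioid F₂)
    (hD₁ : IsOfFSMFFType2024 D₁) (hD₂ : IsOfFSMFFType2024 D₂)
    (hpf₁ : Objectwise (fun M _ => IsPerfFactorial M) Φ₁) (hpf₂ : Objectwise (fun M _ => IsPerfFactorial M) Φ₂)
    (Ψ : C₁ ≌ C₂)
    {Supp₁ : ∀ {X : D₁}, (ofFunctor Φ₁ F₁).Mon X → Primes ((ofFunctor Φ₁ F₁).Mon X) → Prop}
    (hSupp₁ : ∀ (X : D₁) (a : (ofFunctor Φ₁ F₁).Mon X) (𝔭 : Primes ((ofFunctor Φ₁ F₁).Mon X)),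
      Supp₁ a 𝔭 ↔ PrimarySupp a 𝔭)
    (Supp₂ : ∀ {X : D₂}, (ofFunctor Φ₂ F₂).Mon X → Primes ((ofFunctor Φ₂ F₂).Mon X) → Prop) :
    (ofFunctor Φ₁ F₁).Thm49 (ofFunctor Φ₂ F₂) Ψ (rsParams hF₁ Supp₁) (rsParams hF₂ Supp₂) :=
  fun hR₁ hR₂ =>
    thm49_ofFunctor_of_isOfFSMFFType2024 hF₁ hF₂ hD₁ hD₂ hpf₁ hpf₂
      (isRational_primarySupp_of_rsParams hF₁ hSupp₁ hR₁) Ψ _ _ hR₁ hR₂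

/-- **[FrdI] Thm. 4.9 AS TYPED at THE parameters with THE primary support, bases of FSMFF-type (2024)** —
hypotheses = print's standing ones only. [cite: MochizukiFrdI2008, Thm. 4.9 p.88] -/
theorem thm49_rsParams_primarySupp_of_isOfFSMFFType2024 (hF₁ : IsFrobenioid F₁) (hF₂ : IsFrobenioid F₂)
    (hD₁ : IsOfFSMFFType2024 D₁) (hD₂ : IsOfFSMFFType2024 D₂)
    (hpf₁ : Objectwise (fun M _ => IsPerfFactorial M) Φ₁) (hpf₂ : Objectwise (fun M _ => IsPerfFactorial M) Φ₂)
    (Ψ : C₁ ≌ C₂) :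
    (ofFunctor Φ₁ F₁).Thm49 (ofFunctor Φ₂ F₂) Ψ (rsParams hF₁ fun a 𝔭 => PrimarySupp a 𝔭)
      (rsParams hF₂ fun a 𝔭 => PrimarySupp a 𝔭) :=
  thm49_rsParams_of_isOfFSMFFType2024 hF₁ hF₂ hD₁ hD₂ hpf₁ hpf₂ Ψ (fun _ _ _ => Iff.rfl) _

/-! ### Theorem 4.9 at THE parameters, no base hypothesis, modulo "`Ψ^{±1}` preserve pre-steps" -/

/-- **[FrdI] Thm. 4.9 AS TYPED at THE Def. 4.5 (iii) parameters in print's generality, MODULO ONLY "`Ψ`,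
`Ψ⁻¹` preserve pre-steps" (Thm. 3.4 (ii)) — no base hypothesis and no rationality side-hypothesis** (`Supp₁`
extensionally the primary support; closer `thm49_ofFunctor_of_preservesPreSteps`, seat abc-iut-w4-d105).
[cite: MochizukiFrdI2008, Thm. 4.9 p.88] -/
theorem thm49_rsParams_of_preservesPreSteps (hF₁ : IsFrobenioid F₁) (hF₂ : IsFrobenioid F₂)
    (hpf₁ : Objectwise (fun M _ => IsPerfFactorial M) Φ₁) (hpf₂ : Objectwise (fun M _ => IsPerfFactorial M) Φ₂)
    (Ψ : C₁ ≌ C₂)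
    (hpre : ∀ ⦃X Y : C₁⦄ (φ : X ⟶ Y), IsPreStep F₁ φ → IsPreStep F₂ (Ψ.functor.map φ))
    (hpre' : ∀ ⦃X Y : C₂⦄ (φ : X ⟶ Y), IsPreStep F₂ φ → IsPreStep F₁ (Ψ.inverse.map φ))
    {Supp₁ : ∀ {X : D₁}, (ofFunctor Φ₁ F₁).Mon X → Primes ((ofFunctor Φ₁ F₁).Mon X) → Prop}
    (hSupp₁ : ∀ (X : D₁) (a : (ofFunctor Φ₁ F₁).Mon X) (𝔭 : Primes ((ofFunctor Φ₁ F₁).Mon X)),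
      Supp₁ a 𝔭 ↔ PrimarySupp a 𝔭)
    (Supp₂ : ∀ {X : D₂}, (ofFunctor Φ₂ F₂).Mon X → Primes ((ofFunctor Φ₂ F₂).Mon X) → Prop) :
    (ofFunctor Φ₁ F₁).Thm49 (ofFunctor Φ₂ F₂) Ψ (rsParams hF₁ Supp₁) (rsParams hF₂ Supp₂) :=
  fun hR₁ hR₂ =>
    thm49_ofFunctor_of_preservesPreSteps hF₁ hF₂ hpf₁ hpf₂
      (isRational_primarySupp_of_rsParams hF₁ hSupp₁ hR₁) Ψ hpre hpre' _ _ hR₁ hR₂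

/-- **[FrdI] Thm. 4.9 AS TYPED at THE parameters with THE primary support, modulo only "`Ψ^{±1}` preserve
pre-steps"** — hypotheses = Frobenioids, perf-factorial `Φ_i`, and the Thm. 3.4 (ii) clause; no base hypothesis,
no rationality side-hypothesis. [cite: MochizukiFrdI2008, Thm. 4.9 p.88] -/
theorem thm49_rsParams_primarySupp_of_preservesPreSteps (hF₁ : IsFrobenioid F₁) (hF₂ : IsFrobenioid F₂)
    (hpf₁ : Objectwise (fun M _ => IsPerfFactorial M) Φ₁) (hpf₂ : Objectwise (fun M _ => IsPerfFactorial M) Φ₂)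
    (Ψ : C₁ ≌ C₂)
    (hpre : ∀ ⦃X Y : C₁⦄ (φ : X ⟶ Y), IsPreStep F₁ φ → IsPreStep F₂ (Ψ.functor.map φ))
    (hpre' : ∀ ⦃X Y : C₂⦄ (φ : X ⟶ Y), IsPreStep F₂ φ → IsPreStep F₁ (Ψ.inverse.map φ)) :
    (ofFunctor Φ₁ F₁).Thm49 (ofFunctor Φ₂ F₂) Ψ (rsParams hF₁ fun a 𝔭 => PrimarySupp a 𝔭)
      (rsParams hF₂ fun a 𝔭 => PrimarySupp a 𝔭) :=
  thm49_rsParams_of_preservesPreSteps hF₁ hF₂ hpf₁ hpf₂ Ψ hpre hpre' (fun _ _ _ => Iff.rfl) _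

end FrdI.T49

end Literature.AlgebraicGeometry.Frobenioids
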